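import Mathlib
import HarnessLib

/-!
# SoloInformed — telescoping of oriented cell boundaries over a rectangular grid (toolkit for (HT))

File I3 of the (HT) step of the solo-informed programme: the bookkeeping half of "Stokes on a grid".
In an additive commutative group `V` (for us `V = SoloInformedV`, the target of `κ̃`) attach a value
`H j i` to the horizontal edge number `i < N` on level `j ≤ M` and `E i j` to the vertical edge number
`j < M` on column `i ≤ N`.  If every cell `(i,j)` satisfies the oriented boundary relation
`H j i + E (i+1) j − H (j+1) i − E i j = 0` (bottom + right − top − left, the shape produced by
`soloInformed_kzGreen_line`), then the oriented boundary of the whole rectangle vanishes: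
`Σᵢ H 0 i + Σⱼ E N j − Σᵢ H M i − Σⱼ E 0 j = 0` (`soloInformed_grid_telescope`); in particular, when
the bottom and top rows vanish (constant paths), the two side columns have equal sums
(`soloInformed_grid_sides_eq`, also in `Fin`-indexed form).
-/

namespace Summit.KontsevichZagierPeriods.KontsevichZagierPeriods.Theorems

open Finset

variable {V : Type*} [AddCommGroup V]

/-- **Grid telescoping.**  Cellwise oriented boundary relations sum to the boundary of the rectangle. -/
theorem soloInformed_grid_telescope (H E : ℕ → ℕ → V) (N M : ℕ)
    (hcell : ∀ i < N, ∀ j < M, H j i + E (i + 1) j - H (j + 1) i - E i j = 0) :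
    ∑ i ∈ range N, H 0 i + ∑ j ∈ range M, E N j - ∑ i ∈ range N, H M i -
      ∑ j ∈ range M, E 0 j = 0 := by
  have total : ∑ i ∈ range N, ∑ j ∈ range M, (H j i + E (i + 1) j - H (j + 1) i - E i j) = 0 :=
    sum_eq_zero fun i hi => sum_eq_zero fun j hj => hcell i (mem_range.1 hi) j (mem_range.1 hj)
  have hsplit : ∀ i j, H j i + E (i + 1) j - H (j + 1) i - E i j =
      (E (i + 1) j - E i j) - (H (j + 1) i - H j i) := fun i j => by abel
  simp only [hsplit, sum_sub_distrib] at total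
  have hE : ∑ i ∈ range N, ∑ j ∈ range M, (E (i + 1) j - E i j) =
      ∑ j ∈ range M, E N j - ∑ j ∈ range M, E 0 j := by
    rw [sum_comm, ← sum_sub_distrib]
    refine sum_congr rfl fun j _ => ?_
    exact sum_range_sub (fun i => E i j) N
  have hH : ∑ i ∈ range N, ∑ j ∈ range M, (H (j + 1) i - H j i) =
      ∑ i ∈ range N, H M i - ∑ i ∈ range N, H 0 i := by
    rw [← sum_sub_distrib]
    refine sum_congr rfl fun i _ => ?_
    exact sum_range_sub (fun j => H j i) M
  have hE' : ∑ i ∈ range N, ∑ j ∈ range M, E (i + 1) j - ∑ i ∈ range N, ∑ j ∈ range M, E i j =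
      ∑ j ∈ range M, E N j - ∑ j ∈ range M, E 0 j := by rw [← hE, ← sum_sub_distrib]; simp only [sum_sub_distrib]
  have hH' : ∑ i ∈ range N, ∑ j ∈ range M, H (j + 1) i - ∑ i ∈ range N, ∑ j ∈ range M, H j i =
      ∑ i ∈ range N, H M i - ∑ i ∈ range N, H 0 i := by rw [← hH, ← sum_sub_distrib]; simp only [sum_sub_distrib]
  rw [hE', hH'] at total
  rw [← total]
  abel

/-- **Equal side sums.**  If moreover the bottom row (`j = 0`) and the top row (`j = M`) carry the
value `0` (constant paths), the left and right columns have the same sum. -/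
theorem soloInformed_grid_sides_eq (H E : ℕ → ℕ → V) (N M : ℕ)
    (hcell : ∀ i < N, ∀ j < M, H j i + E (i + 1) j - H (j + 1) i - E i j = 0)
    (h0 : ∀ i < N, H 0 i = 0) (hM : ∀ i < N, H M i = 0) :
    ∑ j ∈ range M, E 0 j = ∑ j ∈ range M, E N j := by
  have h := soloInformed_grid_telescope H E N M hcell
  rw [sum_eq_zero fun i hi => h0 i (mem_range.1 hi), sum_eq_zero fun i hi => hM i (mem_range.1 hi),
    zero_add, sub_zero, sub_eq_zero] at h
  exact h.symm

/-- `Fin`-indexed form of `soloInformed_grid_sides_eq` (the shape of `soloInformed_kappaPath_subdiv`). -/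
theorem soloInformed_grid_sides_eq_fin (H E : ℕ → ℕ → V) (N M : ℕ)
    (hcell : ∀ i < N, ∀ j < M, H j i + E (i + 1) j - H (j + 1) i - E i j = 0)
    (h0 : ∀ i < N, H 0 i = 0) (hM : ∀ i < N, H M i = 0) :
    ∑ j : Fin M, E 0 j = ∑ j : Fin M, E N j := by
  rw [Fin.sum_univ_eq_sum_range (fun j => E 0 j) M, Fin.sum_univ_eq_sum_range (fun j => E N j) M]
  exact soloInformed_grid_sides_eq H E N M hcell h0 hM

/-- **Two stacked blocks on the left.**  The situation of (HT): the left column consists of `M₀` edges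
of one path followed by `M₀` edges of a second one (`M = M₀ + M₀`); the right column of `M` edges of a
third.  Cellwise relations and vanishing bottom/top rows give `Σ a + Σ b = Σ d`. -/
theorem soloInformed_grid_concat (H E : ℕ → ℕ → V) (N M₀ : ℕ) (a b d : ℕ → V)
    (hcell : ∀ i < N, ∀ j < M₀ + M₀, H j i + E (i + 1) j - H (j + 1) i - E i j = 0)
    (h0 : ∀ i < N, H 0 i = 0) (hM : ∀ i < N, H (M₀ + M₀) i = 0)
    (ha : ∀ j < M₀, E 0 j = a j) (hb : ∀ j < M₀, E 0 (M₀ + j) = b j)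
    (hd : ∀ j < M₀ + M₀, E N j = d j) :
    ∑ j : Fin M₀, a j + ∑ j : Fin M₀, b j = ∑ j : Fin (M₀ + M₀), d j := by
  have h := soloInformed_grid_sides_eq H E N (M₀ + M₀) hcell h0 hM
  rw [sum_range_add] at h
  rw [Fin.sum_univ_eq_sum_range (fun j => a j) M₀, Fin.sum_univ_eq_sum_range (fun j => b j) M₀,
    Fin.sum_univ_eq_sum_range (fun j => d j) (M₀ + M₀),
    ← sum_congr rfl fun j hj => ha j (mem_range.1 hj),
    ← sum_congr rfl fun j hj => hb j (mem_range.1 hj),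
    ← sum_congr rfl fun j hj => hd j (mem_range.1 hj)]
  exact h

end Summit.KontsevichZagierPeriods.KontsevichZagierPeriods.Theorems
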